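import Summits.BirchSwinnertonDyer.BirchSwinnertonDyer.Theorems.AdditiveBranchIMCTwistRootNumberTwistedClassArith
import Summits.BirchSwinnertonDyer.BirchSwinnertonDyer.Theorems.AdditiveBranchIMCTwistAtTwoSplitFlip
import HarnessLib

/-!
# The local root number at a multiplicative `2` under an unramified quadratic twist: `w₂(E^{(D)}) = χ₈(D)·w₂(E)`
# (crux 19357 `GordTwoRankZeroOffCaseOne`, line `three_field_road`, brick «λ₂-flip»; LEAD g17, `--supports` 19357, helper only)

Theorems only. For `E/ℚ` MULTIPLICATIVE at `2` and `D ≡ 1 (mod 4)`: `w₂(E^{(D)}) = χ₈(D)·w₂(E)` with `χ₈(D) = (D/2)` the Kronecker symbol —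
the local root number at a multiplicative place is `−1` (split) / `+1` (non-split) [Rohrlich, Prop. 2 (ii)], and the split type of `E^{(D)}` at
`2` is that of `E` iff `D ≡ 1 (mod 8)` (`hasSplitMultiplicativeReductionAtPrime_two_quadraticTwist_iff_of_emod_four`, p812548). This is the
`r = 2` factor of the Kronecker form of the E3′ root-number engine (`…TwistRootNumberTwistedKronecker`).
References: [Rohrlich1993Compositio] Prop. 2 (ii); [SilvermanAEC2009] Ex. 10.16, App. A Prop. A.1.1. BSD is proved for no curve.
-/

set_option linter.dupNamespace false
set_option autoImplicit false

noncomputable section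

open scoped Classical

open WeierstrassCurve IsDedekindDomain IsDedekindDomain.HeightOneSpectrum Rat.HeightOneSpectrum Literature.NumberTheory.EllipticCurves

namespace Summit.BirchSwinnertonDyer.BirchSwinnertonDyer.Theorems.TwistRootNumberTwisted

/-- **`w₂(E^{(D)}) = χ₈(D)·w₂(E)` at a multiplicative `2`, `D ≡ 1 (mod 4)`** (place of `ℤ` under `2`): for `D ≡ 1 (mod 8)` the split type and
the local root number are unchanged, for `D ≡ 5 (mod 8)` both flip. [cite: Rohrlich1993Compositio, Prop. 2 (ii)] [cite: SilvermanAEC2009, Ex. 10.16] -/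
theorem localRootNumberAt_two_quadraticTwist_eq_χ₈_mul (W : WeierstrassCurve ℚ) [W.IsElliptic] {D : ℤ} (hD4 : D % 4 = 1)
    (hm : W.HasMultiplicativeReductionAt ((primesEquiv (R := ℤ)).symm ⟨2, Nat.prime_two⟩)) :
    (W.quadraticTwist (D : ℚ)).localRootNumberAt ((primesEquiv (R := ℤ)).symm ⟨2, Nat.prime_two⟩) =
      ZMod.χ₈ (D : ZMod 8) * W.localRootNumberAt ((primesEquiv (R := ℤ)).symm ⟨2, Nat.prime_two⟩) := by
  set P2 : Nat.Primes := ⟨2, Nat.prime_two⟩ with hP2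
  have hD0 : (D : ℚ) ≠ 0 := by
    have : D ≠ 0 := by rintro rfl; simp at hD4
    exact_mod_cast this
  haveI := W.isElliptic_quadraticTwist hD0
  have hmQ : W.HasMultiplicativeReductionAtPrime 2 := (W.hasMultiplicativeReductionAtPrime_iff_hasMultiplicativeReductionAt_holds P2).mpr hm
  have hmQ' : (W.quadraticTwist (D : ℚ)).HasMultiplicativeReductionAtPrime 2 :=
    hasMultiplicativeReductionAtPrime_two_quadraticTwist_of_emod_four W hD4 hmQ
  have hiff := hasSplitMultiplicativeReductionAtPrime_two_quadraticTwist_iff_of_emod_four W hD4 hmQ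
  rw [localRootNumberAt_primesEquiv_symm_eq, localRootNumberAt_primesEquiv_symm_eq, ZMod.χ₈_int_eq_if_mod_eight]
  simp only [show D % 2 ≠ 0 by omega, if_false]
  by_cases h8 : D % 8 = 1
  · -- `D` a `2`-adic square class: nothing changes
    rw [if_pos (Or.inl h8), one_mul]
    by_cases hsp : W.HasSplitMultiplicativeReductionAtPrime 2
    · rw [localRootNumber_of_hasSplitMultiplicativeReduction _ _ (hiff.mpr (iff_of_true h8 hsp)),
        localRootNumber_of_hasSplitMultiplicativeReduction _ _ hsp]
    · rw [localRootNumber_of_hasMultiplicativeReduction _ _ hmQ' (fun h ↦ hsp ((hiff.mp h).mp h8)),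
        localRootNumber_of_hasMultiplicativeReduction _ _ hmQ hsp]
  · -- `D ≡ 5 (mod 8)`: split and non-split are exchanged
    rw [if_neg (by omega), neg_one_mul]
    by_cases hsp : W.HasSplitMultiplicativeReductionAtPrime 2
    · rw [localRootNumber_of_hasMultiplicativeReduction _ _ hmQ' (fun h ↦ h8 ((hiff.mp h).mpr hsp)),
        localRootNumber_of_hasSplitMultiplicativeReduction _ _ hsp]
      norm_num
    · rw [localRootNumber_of_hasSplitMultiplicativeReduction _ _ (hiff.mpr ⟨fun h ↦ absurd h h8, fun h ↦ absurd h hsp⟩),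
        localRootNumber_of_hasMultiplicativeReduction _ _ hmQ hsp]

end Summit.BirchSwinnertonDyer.BirchSwinnertonDyer.Theorems.TwistRootNumberTwisted

end
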